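import Summits.ValiantsHypothesis.ValiantsHypothesis.Theorems.PolyaContinuedLaplaceRigiditySingCodimTools
import Summits.ValiantsHypothesis.ValiantsHypothesis.Theorems.SymPencilPerFourHessianRankThreeZero

/-!
# `codim Sing(per₄) = 8` — zero patterns among the `2 × 2` permanents of a `2 × 4` block

Second helper file (no definitions, no `sorry`) for the exact value `codim Sing(per₄) = 8`
(`…PolyaContinuedLaplaceRigiditySingCodimEight`).  For a `2 × 4` block with rows `u, v` over a
field `L ⊇ F` write `p_kl = u_k v_l + u_l v_k` for its six `2 × 2` permanents.  In generic-point
currency ("the entries are covered by `k` elements" = every entry is algebraic over the subalgebra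
generated by `k` of them, hence `trdeg ≤ k`):

* `cover_of_perm_two_eq_zero` — one relation `p_kl = 0` covers its four entries by three;
* `cover_of_perm_two_star` — `p_ab = p_ac = p_ad = 0` covers the eight entries by six;
* `cover_of_perm_two_all_of_ne_zero`, `cover_of_perm_two_all` — all six `p_kl = 0` (`2 ≠ 0`)
  cover the eight entries by four: the point version of `codim P_{2,4} = 4`
  (Boralevi–Carlini–Michałek–Ventura 2025 Thm. 2.1 at `n = 4`; tree:
  `BoraleviCarliniMichalekVentura2025.thm_2_1`);
* `exists_three_others`, `exists_two_others` — `Fin 4` bookkeeping (with the tree's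
  `SymPencilPerFourHessianRankThreeZero.eq_or_of_four`).

Helper for crux `CoverDecancellation` (stmt-ValiantsHypothesis-17819), line `laplace_rigidity`,
R3 row.  Honest framing: VP ≠ VNP is NOT proved; no summit statement is touched.

## References
* A. Boralevi, E. Carlini, M. Michałek, E. Ventura, *On the codimension of permanental varieties*,
  Adv. Math. 461 (2025) 110079, arXiv:2402.17839, Thm. 2.1. [BoraleviCarliniMichalekVentura2025]
-/

set_option linter.dupNamespace false

noncomputable section

namespace Summit.ValiantsHypothesis.ValiantsHypothesis.Theorems.PolyaContinuedLaplaceRigidity.SingCodim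

open MvPolynomial Cardinal
open Summit.ValiantsHypothesis.ValiantsHypothesis.Theorems.SymPencilPerFourHessianRankThreeZero (eq_or_of_four)

variable {F : Type*} [Field F] {L : Type*} [Field L] [Algebra F L]

/-! ### Zero patterns among the `2 × 2` permanents of a `2 × 4` block -/

/-- One vanishing `2 × 2` permanent `x₁ x₂' + x₂ x₁' = 0`: the four entries are covered by three.
[folklore] -/
theorem cover_of_perm_two_eq_zero (x₁ x₂ x₁' x₂' : L) (h : x₁ * x₂' + x₂ * x₁' = 0) :
    ∃ f : Fin 3 → L, ∀ e ∈ ({x₁, x₂, x₁', x₂'} : Set L),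
      IsAlgebraic (Algebra.adjoin F (Set.range f)) e := by
  by_cases hx₁ : x₁ = 0
  · by_cases hx₂ : x₂ = 0
    · refine ⟨![x₁', x₂', 0], fun e he => ?_⟩
      simp only [Set.mem_insert_iff, Set.mem_singleton_iff] at he
      rcases he with rfl | rfl | rfl | rfl
      · exact alg_of_eq_zero _ hx₁
      · exact alg_of_eq_zero _ hx₂
      · exact alg_of_mem ⟨0, rfl⟩
      · exact alg_of_mem ⟨1, rfl⟩
    · have hx₁' : x₁' = 0 := by
        rw [hx₁, zero_mul, zero_add] at h
        exact (mul_eq_zero.mp h).resolve_left hx₂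
      refine ⟨![x₂, x₂', 0], fun e he => ?_⟩
      simp only [Set.mem_insert_iff, Set.mem_singleton_iff] at he
      rcases he with rfl | rfl | rfl | rfl
      · exact alg_of_eq_zero _ hx₁
      · exact alg_of_mem ⟨0, rfl⟩
      · exact alg_of_eq_zero _ hx₁'
      · exact alg_of_mem ⟨1, rfl⟩
  · refine ⟨![x₁, x₂, x₁'], fun e he => ?_⟩
    simp only [Set.mem_insert_iff, Set.mem_singleton_iff] at he
    rcases he with rfl | rfl | rfl | rfl
    · exact alg_of_mem ⟨0, rfl⟩
    · exact alg_of_mem ⟨1, rfl⟩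
    · exact alg_of_mem ⟨2, rfl⟩
    · refine alg_of_mul_eq (c := x₁) (d := -(x₂ * x₁')) (mem_adjoin_of_mem ⟨0, rfl⟩)
        (neg_mem (mul_mem (mem_adjoin_of_mem ⟨1, rfl⟩) (mem_adjoin_of_mem ⟨2, rfl⟩))) hx₁ ?_
      linear_combination h

/-- Three vanishing `2 × 2` permanents through one index (`x y_k' + y_k x' = 0`, `k = 1,2,3`):
the eight entries are covered by six. [folklore] -/
theorem cover_of_perm_two_star (x y₁ y₂ y₃ x' y₁' y₂' y₃' : L)
    (h₁ : x * y₁' + y₁ * x' = 0) (h₂ : x * y₂' + y₂ * x' = 0) (h₃ : x * y₃' + y₃ * x' = 0) :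
    ∃ f : Fin 6 → L, ∀ e ∈ ({x, y₁, y₂, y₃, x', y₁', y₂', y₃'} : Set L),
      IsAlgebraic (Algebra.adjoin F (Set.range f)) e := by
  by_cases hx : x = 0
  · rw [hx, zero_mul, zero_add] at h₁ h₂ h₃
    by_cases hx' : x' = 0
    · refine ⟨![y₁, y₂, y₃, y₁', y₂', y₃'], fun e he => ?_⟩
      simp only [Set.mem_insert_iff, Set.mem_singleton_iff] at he
      rcases he with rfl | rfl | rfl | rfl | rfl | rfl | rfl | rfl
      · exact alg_of_eq_zero _ hx
      · exact alg_of_mem ⟨0, rfl⟩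
      · exact alg_of_mem ⟨1, rfl⟩
      · exact alg_of_mem ⟨2, rfl⟩
      · exact alg_of_eq_zero _ hx'
      · exact alg_of_mem ⟨3, rfl⟩
      · exact alg_of_mem ⟨4, rfl⟩
      · exact alg_of_mem ⟨5, rfl⟩
    · have hy₁ : y₁ = 0 := (mul_eq_zero.mp h₁).resolve_right hx'
      have hy₂ : y₂ = 0 := (mul_eq_zero.mp h₂).resolve_right hx'
      have hy₃ : y₃ = 0 := (mul_eq_zero.mp h₃).resolve_right hx'
      refine ⟨![x', y₁', y₂', y₃', 0, 0], fun e he => ?_⟩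
      simp only [Set.mem_insert_iff, Set.mem_singleton_iff] at he
      rcases he with rfl | rfl | rfl | rfl | rfl | rfl | rfl | rfl
      · exact alg_of_eq_zero _ hx
      · exact alg_of_eq_zero _ hy₁
      · exact alg_of_eq_zero _ hy₂
      · exact alg_of_eq_zero _ hy₃
      · exact alg_of_mem ⟨0, rfl⟩
      · exact alg_of_mem ⟨1, rfl⟩
      · exact alg_of_mem ⟨2, rfl⟩
      · exact alg_of_mem ⟨3, rfl⟩
  · refine ⟨![x, y₁, y₂, y₃, x', 0], fun e he => ?_⟩
    have hsol : ∀ y y' : L, y ∈ Set.range ![x, y₁, y₂, y₃, x', 0] → x * y' + y * x' = 0 →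
        IsAlgebraic (Algebra.adjoin F (Set.range ![x, y₁, y₂, y₃, x', 0])) y' := by
      intro y y' hy hyy'
      refine alg_of_mul_eq (c := x) (d := -(y * x')) (mem_adjoin_of_mem ⟨0, rfl⟩)
        (neg_mem (mul_mem (mem_adjoin_of_mem hy) (mem_adjoin_of_mem ⟨4, rfl⟩))) hx ?_
      linear_combination hyy'
    simp only [Set.mem_insert_iff, Set.mem_singleton_iff] at he
    rcases he with rfl | rfl | rfl | rfl | rfl | rfl | rfl | rfl
    · exact alg_of_mem ⟨0, rfl⟩
    · exact alg_of_mem ⟨1, rfl⟩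
    · exact alg_of_mem ⟨2, rfl⟩
    · exact alg_of_mem ⟨3, rfl⟩
    · exact alg_of_mem ⟨4, rfl⟩
    · exact hsol y₁ _ ⟨1, rfl⟩ h₁
    · exact hsol y₂ _ ⟨2, rfl⟩ h₂
    · exact hsol y₃ _ ⟨3, rfl⟩ h₃

/-! ### All six `2 × 2` permanents vanish: `trdeg ≤ 4` (the variety `P_{2,4}`) -/

/-- All six `2 × 2` permanents of `[x y₁ y₂ y₃; x' y₁' y₂' y₃']` vanish and `x ≠ 0` (`2 ≠ 0`):
the eight entries are covered by four (in fact three). [folklore] -/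
theorem cover_of_perm_two_all_of_ne_zero (h2 : (2 : L) ≠ 0) (x y₁ y₂ y₃ x' y₁' y₂' y₃' : L)
    (hx : x ≠ 0) (h₁ : x * y₁' + y₁ * x' = 0) (h₂ : x * y₂' + y₂ * x' = 0)
    (h₃ : x * y₃' + y₃ * x' = 0) (h₁₂ : y₁ * y₂' + y₂ * y₁' = 0) (h₁₃ : y₁ * y₃' + y₃ * y₁' = 0)
    (h₂₃ : y₂ * y₃' + y₃ * y₂' = 0) :
    ∃ f : Fin 4 → L, ∀ e ∈ ({x, y₁, y₂, y₃, x', y₁', y₂', y₃'} : Set L),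
      IsAlgebraic (Algebra.adjoin F (Set.range f)) e := by
  -- `2 y_k y_l x' = 0`
  have e₁₂ : y₁ * y₂ * x' = 0 := by
    have h : 2 * (y₁ * y₂ * x') = 0 := by linear_combination (-x) * h₁₂ + y₁ * h₂ + y₂ * h₁
    exact (mul_eq_zero.mp h).resolve_left h2
  have e₁₃ : y₁ * y₃ * x' = 0 := by
    have h : 2 * (y₁ * y₃ * x') = 0 := by linear_combination (-x) * h₁₃ + y₁ * h₃ + y₃ * h₁
    exact (mul_eq_zero.mp h).resolve_left h2
  have e₂₃ : y₂ * y₃ * x' = 0 := by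
    have h : 2 * (y₂ * y₃ * x') = 0 := by linear_combination (-x) * h₂₃ + y₂ * h₃ + y₃ * h₂
    exact (mul_eq_zero.mp h).resolve_left h2
  -- a cover `f` containing `x` at `0` and `x'` at `1` solves every `y_k'` once `y_k ∈ F[f]`
  have hsol : ∀ (f : Fin 4 → L), f 0 = x → f 1 = x' → ∀ y y' : L,
      y ∈ Algebra.adjoin F (Set.range f) → x * y' + y * x' = 0 →
        IsAlgebraic (Algebra.adjoin F (Set.range f)) y' := by
    intro f hf0 hf1 y y' hy hyy'
    refine alg_of_mul_eq (c := x) (d := -(y * x')) (mem_adjoin_of_mem ⟨0, hf0⟩)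
      (neg_mem (mul_mem hy (mem_adjoin_of_mem ⟨1, hf1⟩))) hx ?_
    linear_combination hyy'
  by_cases hx' : x' = 0
  · -- then every `y_k' = 0`
    rw [hx', mul_zero, add_zero] at h₁ h₂ h₃
    have hy₁' : y₁' = 0 := (mul_eq_zero.mp h₁).resolve_left hx
    have hy₂' : y₂' = 0 := (mul_eq_zero.mp h₂).resolve_left hx
    have hy₃' : y₃' = 0 := (mul_eq_zero.mp h₃).resolve_left hx
    refine ⟨![x, y₁, y₂, y₃], fun e he => ?_⟩
    simp only [Set.mem_insert_iff, Set.mem_singleton_iff] at he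
    rcases he with rfl | rfl | rfl | rfl | rfl | rfl | rfl | rfl
    · exact alg_of_mem ⟨0, rfl⟩
    · exact alg_of_mem ⟨1, rfl⟩
    · exact alg_of_mem ⟨2, rfl⟩
    · exact alg_of_mem ⟨3, rfl⟩
    · exact alg_of_eq_zero _ hx'
    · exact alg_of_eq_zero _ hy₁'
    · exact alg_of_eq_zero _ hy₂'
    · exact alg_of_eq_zero _ hy₃'
  · have z₁₂ : y₁ * y₂ = 0 := (mul_eq_zero.mp e₁₂).resolve_right hx'
    have z₁₃ : y₁ * y₃ = 0 := (mul_eq_zero.mp e₁₃).resolve_right hx'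
    have z₂₃ : y₂ * y₃ = 0 := (mul_eq_zero.mp e₂₃).resolve_right hx'
    -- at most one of `y₁, y₂, y₃` is non-zero; call it (or `y₃`) the third generator
    by_cases hy₁ : y₁ = 0
    · by_cases hy₂ : y₂ = 0
      · refine ⟨![x, x', y₃, 0], fun e he => ?_⟩
        have a₁ : y₁ ∈ Algebra.adjoin F (Set.range ![x, x', y₃, 0]) := by rw [hy₁]; exact zero_mem _
        have a₂ : y₂ ∈ Algebra.adjoin F (Set.range ![x, x', y₃, 0]) := by rw [hy₂]; exact zero_mem _
        have a₃ : y₃ ∈ Algebra.adjoin F (Set.range ![x, x', y₃, 0]) := mem_adjoin_of_mem ⟨2, rfl⟩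
        simp only [Set.mem_insert_iff, Set.mem_singleton_iff] at he
        rcases he with rfl | rfl | rfl | rfl | rfl | rfl | rfl | rfl
        · exact alg_of_mem ⟨0, rfl⟩
        · exact alg_of_eq_zero _ hy₁
        · exact alg_of_eq_zero _ hy₂
        · exact alg_of_mem ⟨2, rfl⟩
        · exact alg_of_mem ⟨1, rfl⟩
        · exact hsol _ rfl rfl y₁ _ a₁ h₁
        · exact hsol _ rfl rfl y₂ _ a₂ h₂
        · exact hsol _ rfl rfl y₃ _ a₃ h₃
      · have hy₃ : y₃ = 0 := (mul_eq_zero.mp z₂₃).resolve_left hy₂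
        refine ⟨![x, x', y₂, 0], fun e he => ?_⟩
        have a₁ : y₁ ∈ Algebra.adjoin F (Set.range ![x, x', y₂, 0]) := by rw [hy₁]; exact zero_mem _
        have a₂ : y₂ ∈ Algebra.adjoin F (Set.range ![x, x', y₂, 0]) := mem_adjoin_of_mem ⟨2, rfl⟩
        have a₃ : y₃ ∈ Algebra.adjoin F (Set.range ![x, x', y₂, 0]) := by rw [hy₃]; exact zero_mem _
        simp only [Set.mem_insert_iff, Set.mem_singleton_iff] at he
        rcases he with rfl | rfl | rfl | rfl | rfl | rfl | rfl | rfl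
        · exact alg_of_mem ⟨0, rfl⟩
        · exact alg_of_eq_zero _ hy₁
        · exact alg_of_mem ⟨2, rfl⟩
        · exact alg_of_eq_zero _ hy₃
        · exact alg_of_mem ⟨1, rfl⟩
        · exact hsol _ rfl rfl y₁ _ a₁ h₁
        · exact hsol _ rfl rfl y₂ _ a₂ h₂
        · exact hsol _ rfl rfl y₃ _ a₃ h₃
    · have hy₂ : y₂ = 0 := (mul_eq_zero.mp z₁₂).resolve_left hy₁
      have hy₃ : y₃ = 0 := (mul_eq_zero.mp z₁₃).resolve_left hy₁
      refine ⟨![x, x', y₁, 0], fun e he => ?_⟩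
      have a₁ : y₁ ∈ Algebra.adjoin F (Set.range ![x, x', y₁, 0]) := mem_adjoin_of_mem ⟨2, rfl⟩
      have a₂ : y₂ ∈ Algebra.adjoin F (Set.range ![x, x', y₁, 0]) := by rw [hy₂]; exact zero_mem _
      have a₃ : y₃ ∈ Algebra.adjoin F (Set.range ![x, x', y₁, 0]) := by rw [hy₃]; exact zero_mem _
      simp only [Set.mem_insert_iff, Set.mem_singleton_iff] at he
      rcases he with rfl | rfl | rfl | rfl | rfl | rfl | rfl | rfl
      · exact alg_of_mem ⟨0, rfl⟩
      · exact alg_of_mem ⟨2, rfl⟩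
      · exact alg_of_eq_zero _ hy₂
      · exact alg_of_eq_zero _ hy₃
      · exact alg_of_mem ⟨1, rfl⟩
      · exact hsol _ rfl rfl y₁ _ a₁ h₁
      · exact hsol _ rfl rfl y₂ _ a₂ h₂
      · exact hsol _ rfl rfl y₃ _ a₃ h₃

/-! ### Index bookkeeping on `Fin 4` -/

/-- The three indices other than `k`. -/
theorem exists_three_others (k : Fin 4) :
    ∃ l m n : Fin 4, k ≠ l ∧ k ≠ m ∧ k ≠ n ∧ l ≠ m ∧ l ≠ n ∧ m ≠ n := by
  revert k; decide

/-- The two indices other than `c ≠ d`. -/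
theorem exists_two_others (c d : Fin 4) (hcd : c ≠ d) :
    ∃ a b : Fin 4, a ≠ b ∧ a ≠ c ∧ a ≠ d ∧ b ≠ c ∧ b ≠ d := by
  revert c d; decide

/-- **`P_{2,4}`**: if all six `2 × 2` permanents of the `2 × 4` block `[u; v]` vanish (`2 ≠ 0`), the
eight entries are covered by four (`codim P_{2,4} = 4`, BCMV Thm. 2.1 for `n = 4`, here at a point).
[cite: BoraleviCarliniMichalekVentura2025, Thm. 2.1] -/
theorem cover_of_perm_two_all (h2 : (2 : L) ≠ 0) (u v : Fin 4 → L)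
    (hp : ∀ i j : Fin 4, i ≠ j → u i * v j + u j * v i = 0) :
    ∃ f : Fin 4 → L, ∀ e ∈ Set.range u ∪ Set.range v,
      IsAlgebraic (Algebra.adjoin F (Set.range f)) e := by
  by_cases hu : ∀ i, u i = 0
  · refine ⟨v, fun e he => ?_⟩
    rcases he with ⟨i, rfl⟩ | ⟨i, rfl⟩
    · exact alg_of_eq_zero _ (hu i)
    · exact alg_of_mem ⟨i, rfl⟩
  · push Not at hu
    obtain ⟨k, hk⟩ := hu
    obtain ⟨l, m, n, hkl, hkm, hkn, hlm, hln, hmn⟩ := exists_three_others k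
    obtain ⟨f, hf⟩ := cover_of_perm_two_all_of_ne_zero (F := F) h2 (u k) (u l) (u m) (u n)
      (v k) (v l) (v m) (v n) hk (hp k l hkl) (hp k m hkm) (hp k n hkn) (hp l m hlm) (hp l n hln)
      (hp m n hmn)
    refine ⟨f, fun e he => hf e ?_⟩
    rcases he with ⟨i, rfl⟩ | ⟨i, rfl⟩ <;>
      rcases eq_or_of_four k l m n hkl hkm hkn hlm hln hmn i with rfl | rfl | rfl | rfl <;>
      simp

end Summit.ValiantsHypothesis.ValiantsHypothesis.Theorems.PolyaContinuedLaplaceRigidity.SingCodim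

end
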